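import Literature.NumberTheory.EllipticCurves.GoodReductionInertia
import HarnessLib

/-!
# Reduction of points modulo a valuation (Silverman AEC VII.§2–§3: Prop. VII.2.1 and Prop. VII.3.1)

Silverman, *The Arithmetic of Elliptic Curves*, 2nd ed., VII.§2 "Reduction modulo `π`" (held PDF
pp. 166–169): for a Weierstrass equation with coefficients in a valuation ring `R ⊆ K` one
reduces coefficients and points modulo the maximal ideal, `P ↦ P̃ ∈ Ẽ(k)`; **Prop. VII.2.1**
(p. 167): `0 → E₁(K) → E₀(K) → Ẽ_ns(k) → 0` is exact — in particular the reduction map is a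
homomorphism, with kernel the *kernel of reduction* `E₁(K) = {P ∈ E(K) : P̃ = Õ}` (`O` together
with the non-integral affine points); **Prop. VII.3.1** (p. 170): for `m` prime to `char k`,
**(a)** `E₁(K)` has no nontrivial points of order `m` (prime-to-`p` torsion points are integral),
and **(b)** if moreover `Ẽ` is nonsingular, the reduction map `E(K)[m] → Ẽ(k)` is injective.

This file supplies these statements in the elementary valuation-theoretic setting of the tree
file `GoodReductionInertia` — an arbitrary field `L` with a valuation `w : Valuation L ℝ≥0`, a
`w`-integral Weierstrass equation `V` (Mathlib `WeierstrassCurve.IsIntegral w.integer`) with unit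
discriminant `w Δ = 1` (good reduction), and a ring homomorphism `r : 𝒪_w → k` with kernel
`𝔪_w = {w < 1}` into a field `k` (the residue map followed by any embedding of the residue
field) — in the generality needed to reduce torsion points of an elliptic curve over a number
field inside `K̄_v` (consumer: `HasseWeilGoodReductionFrobeniusProofs`, the reduction
isomorphism `T_ℓ E ≅ T_ℓ Ẽ_v`):

* `Literature.reduceFun r : L → k` (the residue map extended by `0`), `Literature.reduceCurve r V` (the reduced
  equation `Ṽ`; `= M.map r` for a model `M` over `𝒪_w`, `reduceCurve_baseChange`; an elliptic
  curve, `isElliptic_reduceCurve`), `Literature.reducePoint w r Ṽ : V(L) → Ṽ(k)` (**the reduction map**,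
  into any `Ṽ` equal to the reduced equation; `O` and the kernel of reduction go to `Õ`,
  integral affine points to `(x̃, ỹ)`, `reducePoint_some`), `Literature.IsIntegralPoint w P`
  (`P = O` or `w x(P) ≤ 1`, i.e. `P = O` or `P ∉ E₁`);
* `Literature.NumberTheory.EllipticCurves.val_slope_le_one` — the heart of **VII.2.1** made explicit on the chord–tangent formulas:
  for integral `P, Q` with `P̃ ≠ -Q̃` the slope of the line through `P, Q` is integral and reduces
  to the slope through `P̃, Q̃` (three cases: `x̃₁ ≠ x̃₂`; `P = Q`; `x̃₁ = x̃₂`, `x₁ ≠ x₂`, where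
  `λ = (x₁² + x₁x₂ + x₂² + a₂(x₁ + x₂) + a₄ - a₁y₁)/(y₁ + y₂ + a₁x₂ + a₃)` by subtracting the two
  equations — Silverman's "the reduction of the line is the line through the reductions",
  Lemma VII.2.1.1);
* `Literature.NumberTheory.EllipticCurves.reducePoint_add` (**VII.2.1 on integral points**): if `P`, `Q` are integral then
  `\widetilde{P + Q} = P̃ + Q̃` (the case `P̃ = -Q̃`, where `P + Q ∈ E₁`, through the tree's
  `Literature.NumberTheory.EllipticCurves.add_eq_zero_or_one_lt_val`); `reducePoint_neg`; `reducePoint_eq_zero_iff` (`ker = E₁`);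
* `Literature.goodTorsion w V` (points killed by some `n` with `w n = 1`: the prime-to-`p` torsion, all
  integral by the tree's `Literature.NumberTheory.EllipticCurves.val_le_one_of_zsmul_eq_zero` = VII.3.1(a) in valuation form),
  `Literature.reduceHom w r hr hΔ hṼ : goodTorsion w V →+ Ṽ(k)` (**the reduction homomorphism on
  prime-to-`p` torsion**) and `Literature.NumberTheory.EllipticCurves.injective_reduceHom` (**VII.3.1(b)**); `reducePoint_zsmul`.

What is *not* done here: surjectivity `E₀(K) → Ẽ_ns(k)` (Hensel, needs completeness) and the
homomorphism property on all of `E₀(K)` (the case of two points of `E₁`, which Silverman treats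
with the formal group, IV.§1–2); neither is needed for torsion.

## References

* [SilvermanAEC2009] J. H. Silverman, *The Arithmetic of Elliptic Curves*, 2nd ed., GTM 106,
  Springer 2009 (held: `book:silverman2009-arithmetic-elliptic-curves-2nd-ed`): VII.§2,
  Prop. VII.2.1 with Lemma VII.2.1.1 (PDF pp. 166–169), VII.§3, Prop. VII.3.1(a),(b) (PDF p. 170;
  restated as Prop. VIII.1.4, PDF p. 187), III.§2 Group Law Algorithm 2.3 (the chord–tangent
  formulas).

## Mathlib / tree reuse

Mathlib: `Valuation.integer`, `WeierstrassCurve.IsIntegral`/`map`/`baseChange`,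
`Affine.Point` (`add_some`, `add_of_Y_eq`, `neg_some`, `some_ne_zero`, `map_negY`, `map_addX`,
`map_addY`, `slope_of_X_ne`, `slope_of_Y_ne`, `Y_eq_of_Y_ne`, `Equation.map`, `map_equation`,
`equation_iff_nonsingular_of_Δ_ne_zero`), `AddMonoidHom.codRestrict`.  Tree
(`GoodReductionInertia`): `Literature.NumberTheory.EllipticCurves.val_y_le_one`, `Literature.NumberTheory.EllipticCurves.val_le_one_of_zsmul_eq_zero`,
`Literature.NumberTheory.EllipticCurves.add_eq_zero_or_one_lt_val`.

## Design

* Same conventions as `GoodReductionInertia`: `noncomputable section`, `open scoped Classical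
  NNReal`, value group `ℝ≥0`, integrality through Mathlib's `IsIntegral w.integer` (proofs pass to
  a model `M` over `𝒪_w` by `obtain ⟨M, rfl⟩ := hV.integral` and compute with coercions
  `𝒪_w → L`, lemmas `coe_model_*`).
* The residue map is an arbitrary `r : w.integer →+* k` into a field; the hypothesis
  `hr : ∀ a, r a = 0 ↔ w a < 1` (`ker r = 𝔪_w`) is threaded explicitly where needed.  The target
  equation `Ṽ` of `reducePoint` is a free parameter with the hypothesis `hṼ : reduceCurve r V = Ṽ`,
  so that consumers land directly in the points of their own presentation of the reduced curve
  (e.g. `(W.reductionAt v).baseChange k̄_v`) without transporting points along an equality of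
  equations.
* Everything lives in `namespace Literature`; genuine definitions (`reduceFun`, `reduceCurve`,
  `reducePoint`, `IsIntegralPoint`, `goodTorsion`, `reduceHom`) with unfolding lemmas; no
  instances, no `sorry`; axioms of every theorem: `propext`, `Classical.choice`, `Quot.sound`.
-/

noncomputable section

open scoped Classical NNReal
open Polynomial WeierstrassCurve

universe u v

namespace Literature.NumberTheory.EllipticCurves

variable {L : Type u} [Field L] {w : Valuation L ℝ≥0} {k : Type v} [Field k]

/-! ## The residue map, extended by zero to `L` -/

/-- The **reduction map on elements** attached to a ring homomorphism `r : 𝒪_w → k` out of the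
valuation ring `𝒪_w = w.integer` (typically the residue map followed by an embedding of the
residue field): `z ↦ r z` if `w z ≤ 1` and `z ↦ 0` otherwise (a junk value, never used).
Silverman, *AEC*, VII.§2 ("reduction modulo `π`", the map `K ⊇ R → R/πR = k` written `t ↦ t̃`).
[cite: SilvermanAEC2009, VII.§2] -/
def reduceFun (r : w.integer →+* k) (z : L) : k :=
  if h : w z ≤ 1 then r ⟨z, h⟩ else 0

variable (r : w.integer →+* k)

/-- On `w`-integral elements `reduceFun r` is `r`. [folklore] -/
theorem reduceFun_of_le {z : L} (h : w z ≤ 1) : reduceFun r z = r ⟨z, h⟩ :=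
  dif_pos h

/-- Off the valuation ring `reduceFun r` is the junk value `0`. [folklore] -/
theorem reduceFun_of_one_lt {z : L} (h : 1 < w z) : reduceFun r z = 0 :=
  dif_neg (not_le.mpr h)

/-- On elements of `𝒪_w`, `reduceFun r` is `r`. [folklore] -/
@[simp]
theorem reduceFun_coe (a : w.integer) : reduceFun r (a : L) = r a :=
  reduceFun_of_le r a.2

/-- `reduceFun r 0 = 0`. [folklore] -/
@[simp]
theorem reduceFun_zero : reduceFun r (0 : L) = 0 := by
  rw [reduceFun_of_le r (by simp), ← map_zero r]
  rfl

/-- `reduceFun r 1 = 1`. [folklore] -/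
@[simp]
theorem reduceFun_one : reduceFun r (1 : L) = 1 := by
  rw [reduceFun_of_le r (le_of_eq (map_one w)), ← map_one r]
  rfl

/-- `reduceFun r` is additive on `𝒪_w`. [folklore] -/
theorem reduceFun_add {z z' : L} (hz : w z ≤ 1) (hz' : w z' ≤ 1) :
    reduceFun r (z + z') = reduceFun r z + reduceFun r z' := by
  rw [reduceFun_of_le r hz, reduceFun_of_le r hz', ← map_add,
    reduceFun_of_le r (w.map_add_le hz hz')]
  rfl

/-- `reduceFun r` is multiplicative on `𝒪_w`. [folklore] -/
theorem reduceFun_mul {z z' : L} (hz : w z ≤ 1) (hz' : w z' ≤ 1) :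
    reduceFun r (z * z') = reduceFun r z * reduceFun r z' := by
  have h : w (z * z') ≤ 1 := by
    rw [map_mul]
    exact mul_le_one' hz hz'
  rw [reduceFun_of_le r hz, reduceFun_of_le r hz', ← map_mul, reduceFun_of_le r h]
  rfl

/-- `reduceFun r` commutes with negation on `𝒪_w`. [folklore] -/
theorem reduceFun_neg {z : L} (hz : w z ≤ 1) : reduceFun r (-z) = -reduceFun r z := by
  have h : w (-z) ≤ 1 := by rwa [Valuation.map_neg]
  rw [reduceFun_of_le r hz, ← map_neg, reduceFun_of_le r h]
  rfl

/-- `reduceFun r` commutes with subtraction on `𝒪_w`. [folklore] -/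
theorem reduceFun_sub {z z' : L} (hz : w z ≤ 1) (hz' : w z' ≤ 1) :
    reduceFun r (z - z') = reduceFun r z - reduceFun r z' := by
  rw [sub_eq_add_neg, reduceFun_add r hz (by rwa [Valuation.map_neg]), reduceFun_neg r hz',
    sub_eq_add_neg]

/-- `reduceFun r` commutes with powers on `𝒪_w`. [folklore] -/
theorem reduceFun_pow {z : L} (hz : w z ≤ 1) (n : ℕ) : reduceFun r (z ^ n) = reduceFun r z ^ n := by
  have h : w (z ^ n) ≤ 1 := by
    rw [map_pow]
    exact pow_le_one₀ zero_le hz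
  rw [reduceFun_of_le r hz, ← map_pow, reduceFun_of_le r h]
  rfl

/-- `reduceFun r` fixes natural number casts. [folklore] -/
@[simp]
theorem reduceFun_natCast (n : ℕ) : reduceFun r (n : L) = n := by
  rw [← map_natCast r n, ← reduceFun_coe r (n : w.integer)]
  norm_cast

/-- `reduceFun r` fixes integer casts. [folklore] -/
@[simp]
theorem reduceFun_intCast (n : ℤ) : reduceFun r (n : L) = n := by
  rw [← map_intCast r n, ← reduceFun_coe r (n : w.integer)]
  norm_cast

variable {r}

/-!
### When `ker r = 𝔪_w`

The hypothesis `hr : ∀ a, r a = 0 ↔ w a < 1` says that `r` is the residue map `𝒪_w → 𝒪_w/𝔪_w`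
followed by an embedding of fields; then `reduceFun r z = reduceFun r z'` for integral `z, z'`
means `z ≡ z' (mod 𝔪_w)`.
-/

/-- For `ker r = 𝔪_w`: an integral element reduces to `0` iff it lies in `𝔪_w`. [folklore] -/
theorem reduceFun_eq_zero_iff (hr : ∀ a : w.integer, r a = 0 ↔ w (a : L) < 1) {z : L}
    (hz : w z ≤ 1) : reduceFun r z = 0 ↔ w z < 1 := by
  rw [reduceFun_of_le r hz, hr]

/-- For `ker r = 𝔪_w`: a unit of `𝒪_w` has nonzero reduction. [folklore] -/
theorem reduceFun_ne_zero (hr : ∀ a : w.integer, r a = 0 ↔ w (a : L) < 1) {z : L}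
    (hz : w z = 1) : reduceFun r z ≠ 0 := by
  rw [ne_eq, reduceFun_eq_zero_iff hr hz.le, hz]
  exact lt_irrefl 1

/-- For `ker r = 𝔪_w`: two integral elements have the same reduction iff they are congruent
modulo `𝔪_w`. [folklore] -/
theorem reduceFun_eq_iff (hr : ∀ a : w.integer, r a = 0 ↔ w (a : L) < 1) {z z' : L}
    (hz : w z ≤ 1) (hz' : w z' ≤ 1) : reduceFun r z = reduceFun r z' ↔ w (z - z') < 1 := by
  rw [← sub_eq_zero, ← reduceFun_sub r hz hz', reduceFun_eq_zero_iff hr (w.map_sub_le hz hz')]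

/-- For `ker r = 𝔪_w`: reduction of a quotient by a unit. [folklore] -/
theorem reduceFun_div (hr : ∀ a : w.integer, r a = 0 ↔ w (a : L) < 1) {z d : L} (hz : w z ≤ 1)
    (hd : w d = 1) : reduceFun r (z / d) = reduceFun r z / reduceFun r d := by
  have hd0 : d ≠ 0 := by
    rintro rfl
    rw [map_zero] at hd
    exact zero_ne_one hd
  have hzd : w (z / d) ≤ 1 := by rwa [map_div₀, hd, div_one]
  rw [eq_div_iff (reduceFun_ne_zero hr hd), ← reduceFun_mul r hzd hd.le, div_mul_cancel₀ z hd0]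

/-! ## The reduced Weierstrass equation -/

variable (r)

/-- The **reduced Weierstrass equation** `Ṽ` over `k` of a Weierstrass equation `V` over `L`:
coefficientwise `reduceFun r` (meaningful when `V` is `w`-integral: then for `V = M_L` with `M`
over `𝒪_w` it is `M.map r`, `reduceCurve_baseChange`).  Silverman, *AEC*, VII.§2 (the reduced
curve `Ẽ : y² + ã₁xy + ã₃y = x³ + ã₂x² + ã₄x + ã₆`). [cite: SilvermanAEC2009, VII.§2] -/
def reduceCurve (V : WeierstrassCurve L) : WeierstrassCurve k :=
  ⟨reduceFun r V.a₁, reduceFun r V.a₂, reduceFun r V.a₃, reduceFun r V.a₄, reduceFun r V.a₆⟩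

/-- Coefficient `ã₁` of the reduced equation. [folklore] -/
@[simp] theorem reduceCurve_a₁ (V : WeierstrassCurve L) :
    (reduceCurve r V).a₁ = reduceFun r V.a₁ := rfl
/-- Coefficient `ã₂` of the reduced equation. [folklore] -/
@[simp] theorem reduceCurve_a₂ (V : WeierstrassCurve L) :
    (reduceCurve r V).a₂ = reduceFun r V.a₂ := rfl
/-- Coefficient `ã₃` of the reduced equation. [folklore] -/
@[simp] theorem reduceCurve_a₃ (V : WeierstrassCurve L) :
    (reduceCurve r V).a₃ = reduceFun r V.a₃ := rfl
/-- Coefficient `ã₄` of the reduced equation. [folklore] -/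
@[simp] theorem reduceCurve_a₄ (V : WeierstrassCurve L) :
    (reduceCurve r V).a₄ = reduceFun r V.a₄ := rfl
/-- Coefficient `ã₆` of the reduced equation. [folklore] -/
@[simp] theorem reduceCurve_a₆ (V : WeierstrassCurve L) :
    (reduceCurve r V).a₆ = reduceFun r V.a₆ := rfl

section Model

variable (M : WeierstrassCurve w.integer)

omit [Field k] in
/-- Coefficient `a₁` of `M_L` is that of `M`. [folklore] -/
private theorem coe_a₁ : (M.baseChange L).a₁ = (M.a₁ : L) := rfl
omit [Field k] in
/-- Coefficient `a₂` of `M_L` is that of `M`. [folklore] -/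
private theorem coe_a₂ : (M.baseChange L).a₂ = (M.a₂ : L) := rfl
omit [Field k] in
/-- Coefficient `a₃` of `M_L` is that of `M`. [folklore] -/
private theorem coe_a₃ : (M.baseChange L).a₃ = (M.a₃ : L) := rfl
omit [Field k] in
/-- Coefficient `a₄` of `M_L` is that of `M`. [folklore] -/
private theorem coe_a₄ : (M.baseChange L).a₄ = (M.a₄ : L) := rfl
omit [Field k] in
/-- Coefficient `a₆` of `M_L` is that of `M`. [folklore] -/
private theorem coe_a₆ : (M.baseChange L).a₆ = (M.a₆ : L) := rfl

/-- For a model `M` over `𝒪_w`, the reduced equation of `M_L` is `M.map r`.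
Silverman, *AEC*, VII.§2. [folklore] -/
theorem reduceCurve_baseChange : reduceCurve r (M.baseChange L) = M.map r := by
  ext
  · exact reduceFun_coe r M.a₁
  · exact reduceFun_coe r M.a₂
  · exact reduceFun_coe r M.a₃
  · exact reduceFun_coe r M.a₄
  · exact reduceFun_coe r M.a₆

omit [Field k] in
/-- The discriminant of `M_L` is that of `M`. [folklore] -/
theorem coe_model_Δ : (M.baseChange L).Δ = ((M.Δ : w.integer) : L) := by
  rw [baseChange, map_Δ]
  rfl

omit [Field k] in
/-- The equation of `M` at integral points is that of `M_L`. [folklore] -/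
theorem model_equation_iff_coe (X Y : w.integer) :
    M.toAffine.Equation X Y ↔ (M.baseChange L).toAffine.Equation (X : L) (Y : L) := by
  rw [← Affine.map_equation (W := M.toAffine) (f := algebraMap w.integer L)
    Subtype.coe_injective X Y]
  rfl

omit [Field k] in
/-- `negY` of `M_L` at integral arguments. [folklore] -/
theorem coe_model_negY (X Y : w.integer) :
    (M.baseChange L).toAffine.negY X Y = ((M.toAffine.negY X Y : w.integer) : L) := by
  simp only [Affine.negY, coe_a₁, coe_a₃]
  push_cast
  ring

omit [Field k] in
/-- `addX` of `M_L` at integral arguments. [folklore] -/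
theorem coe_model_addX (X₁ X₂ Λ : w.integer) :
    (M.baseChange L).toAffine.addX X₁ X₂ Λ = ((M.toAffine.addX X₁ X₂ Λ : w.integer) : L) := by
  simp only [Affine.addX, coe_a₁, coe_a₂]
  push_cast
  ring

omit [Field k] in
/-- `addY` of `M_L` at integral arguments. [folklore] -/
theorem coe_model_addY (X₁ X₂ Y₁ Λ : w.integer) :
    (M.baseChange L).toAffine.addY X₁ X₂ Y₁ Λ =
      ((M.toAffine.addY X₁ X₂ Y₁ Λ : w.integer) : L) := by
  simp only [Affine.addY, Affine.negAddY, Affine.negY, Affine.addX, coe_a₁, coe_a₂, coe_a₃]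
  push_cast
  ring

end Model

variable {r} {V : WeierstrassCurve L}

/-- Interoperability with Mathlib's `WeierstrassCurve.integralModel`: for a `w`-integral `V`, the
reduced equation is the coefficientwise image under `r` of (any, in particular Mathlib's chosen)
model of `V` over `𝒪_w`. [folklore] -/
theorem reduceCurve_eq_map_integralModel [V.IsIntegral w.integer] :
    reduceCurve r V = (V.integralModel w.integer).map r := by
  conv_lhs => rw [← baseChange_integralModel_eq w.integer V]
  exact reduceCurve_baseChange r _

/-- **Unit discriminant: the reduced equation is nonsingular.** If `V` is `w`-integral with
`w Δ = 1` and `ker r = 𝔪_w`, then `Δ(Ṽ) ≠ 0`. Silverman, *AEC*, VII.§2 ("if `v(Δ) = 0` then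
`Ẽ` is nonsingular") and VII.5.1(a). [cite: SilvermanAEC2009, VII.§2 and Prop. VII.5.1(a)] -/
theorem reduceCurve_Δ_ne_zero [hV : V.IsIntegral w.integer]
    (hr : ∀ a : w.integer, r a = 0 ↔ w (a : L) < 1) (hΔ : w V.Δ = 1) :
    (reduceCurve r V).Δ ≠ 0 := by
  obtain ⟨M, rfl⟩ := hV.integral
  rw [reduceCurve_baseChange, map_Δ, ← reduceFun_coe]
  rw [coe_model_Δ] at hΔ
  exact reduceFun_ne_zero hr hΔ

/-- The reduced equation of an integral equation with unit discriminant is an elliptic curve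
over `k`. Silverman, *AEC*, VII.5.1(a). [cite: SilvermanAEC2009, Prop. VII.5.1(a)] -/
theorem isElliptic_reduceCurve [V.IsIntegral w.integer]
    (hr : ∀ a : w.integer, r a = 0 ↔ w (a : L) < 1) (hΔ : w V.Δ = 1) :
    (reduceCurve r V).IsElliptic :=
  (reduceCurve r V).isElliptic_iff.mpr (isUnit_iff_ne_zero.mpr (reduceCurve_Δ_ne_zero hr hΔ))

/-- **An integral point reduces to a point of the reduced curve**: if `(x, y) ∈ V(L)` with
`w x ≤ 1` (hence `w y ≤ 1`), then `(x̃, ỹ)` satisfies the reduced equation.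
Silverman, *AEC*, VII.§2 (the reduction map `E(K) → Ẽ(k)`, `P ↦ P̃`).
[cite: SilvermanAEC2009, VII.§2] -/
theorem equation_reduceFun [hV : V.IsIntegral w.integer] {x y : L} (he : V.toAffine.Equation x y)
    (hx : w x ≤ 1) (hy : w y ≤ 1) :
    (reduceCurve r V).toAffine.Equation (reduceFun r x) (reduceFun r y) := by
  obtain ⟨M, rfl⟩ := hV.integral
  have he' : M.toAffine.Equation ⟨x, hx⟩ ⟨y, hy⟩ := (model_equation_iff_coe M _ _).mpr he
  rw [reduceCurve_baseChange, reduceFun_of_le r hx, reduceFun_of_le r hy]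
  exact Affine.Equation.map r he'

/-- **Good reduction: an integral point reduces to a nonsingular point** (`w Δ = 1`,
`ker r = 𝔪_w`). Silverman, *AEC*, VII.§2 with III.1.4. [cite: SilvermanAEC2009, VII.§2] -/
theorem nonsingular_reduceFun [V.IsIntegral w.integer]
    (hr : ∀ a : w.integer, r a = 0 ↔ w (a : L) < 1) (hΔ : w V.Δ = 1) {x y : L}
    (he : V.toAffine.Equation x y) (hx : w x ≤ 1) :
    (reduceCurve r V).toAffine.Nonsingular (reduceFun r x) (reduceFun r y) :=
  (Affine.equation_iff_nonsingular_of_Δ_ne_zero (reduceCurve_Δ_ne_zero hr hΔ)).mp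
    (equation_reduceFun he hx (val_y_le_one he hx))

/-- Reduction of `negY`: `\widetilde{negY(x, y)} = negY(x̃, ỹ)` at integral arguments. [folklore] -/
theorem reduceFun_negY [hV : V.IsIntegral w.integer] {x y : L} (hx : w x ≤ 1) (hy : w y ≤ 1) :
    reduceFun r (V.toAffine.negY x y) =
      (reduceCurve r V).toAffine.negY (reduceFun r x) (reduceFun r y) := by
  obtain ⟨M, rfl⟩ := hV.integral
  obtain ⟨X, rfl⟩ : ∃ X : w.integer, (X : L) = x := ⟨⟨x, hx⟩, rfl⟩
  obtain ⟨Y, rfl⟩ : ∃ Y : w.integer, (Y : L) = y := ⟨⟨y, hy⟩, rfl⟩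
  rw [coe_model_negY, reduceFun_coe, reduceFun_coe, reduceFun_coe, reduceCurve_baseChange,
    Affine.map_negY]

/-! ## The slope of the line through two integral points with `P̃ ≠ -Q̃` reduces to the slope -/

/-- **Reduction of the slope (the generic cases of AEC VII.2.1).** On a `w`-integral equation
with `w Δ = 1`, let `P = (x₁, y₁)`, `Q = (x₂, y₂)` be integral points whose reductions are *not*
opposite, `P̃ ≠ -Q̃` (i.e. not both `x₁ ≡ x₂` and `y₁ ≡ -y₂ - a₁x₂ - a₃ (mod 𝔪_w)`). Then the
slope `λ` of the line through `P, Q` (the tangent if `P = Q`) is integral and reduces to the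
slope of the line through `P̃, Q̃` on the reduced curve.  Cases: `x̃₁ ≠ x̃₂` — then
`λ = (y₁ - y₂)/(x₁ - x₂)` with unit denominator; `x̃₁ = x̃₂` — then `ỹ₁ = ỹ₂`, the reduced slope
is the tangent slope, and either `P = Q` (tangent, unit denominator `2y₁ + a₁x₁ + a₃`) or
`x₁ ≠ x₂` and `λ = (x₁² + x₁x₂ + x₂² + a₂(x₁ + x₂) + a₄ - a₁y₁)/(y₁ + y₂ + a₁x₂ + a₃)` by
subtracting the two Weierstrass equations (Silverman's "the reduction of a line is a line",
made explicit). Silverman, *AEC*, Prop. VII.2.1 and its proof.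
[cite: SilvermanAEC2009, Prop. VII.2.1 (proof)] -/
theorem val_slope_le_one [hV : V.IsIntegral w.integer]
    (hr : ∀ a : w.integer, r a = 0 ↔ w (a : L) < 1) (hΔ : w V.Δ = 1) {x₁ y₁ x₂ y₂ : L}
    (h₁ : V.toAffine.Nonsingular x₁ y₁) (h₂ : V.toAffine.Nonsingular x₂ y₂)
    (hx₁ : w x₁ ≤ 1) (hx₂ : w x₂ ≤ 1)
    (hne : ¬(w (x₁ - x₂) < 1 ∧ w (y₁ - V.toAffine.negY x₂ y₂) < 1)) :
    w (V.toAffine.slope x₁ x₂ y₁ y₂) ≤ 1 ∧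
      reduceFun r (V.toAffine.slope x₁ x₂ y₁ y₂) =
        (reduceCurve r V).toAffine.slope (reduceFun r x₁) (reduceFun r x₂) (reduceFun r y₁)
          (reduceFun r y₂) := by
  have hy₁ : w y₁ ≤ 1 := val_y_le_one h₁.1 hx₁
  have hy₂ : w y₂ ≤ 1 := val_y_le_one h₂.1 hx₂
  have hre₁ := equation_reduceFun (r := r) h₁.1 hx₁ hy₁
  have hre₂ := equation_reduceFun (r := r) h₂.1 hx₂ hy₂
  obtain ⟨M, rfl⟩ := hV.integral
  obtain ⟨X₁, rfl⟩ : ∃ X : w.integer, (X : L) = x₁ := ⟨⟨x₁, hx₁⟩, rfl⟩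
  obtain ⟨Y₁, rfl⟩ : ∃ Y : w.integer, (Y : L) = y₁ := ⟨⟨y₁, hy₁⟩, rfl⟩
  obtain ⟨X₂, rfl⟩ : ∃ X : w.integer, (X : L) = x₂ := ⟨⟨x₂, hx₂⟩, rfl⟩
  obtain ⟨Y₂, rfl⟩ : ∃ Y : w.integer, (Y : L) = y₂ := ⟨⟨y₂, hy₂⟩, rfl⟩
  have he₁ : M.toAffine.Equation X₁ Y₁ := (model_equation_iff_coe M _ _).mpr h₁.1
  have he₂ : M.toAffine.Equation X₂ Y₂ := (model_equation_iff_coe M _ _).mpr h₂.1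
  -- abbreviations
  set V := M.baseChange L with hVdef
  simp only [reduceFun_coe] at hre₁ hre₂ ⊢
  rw [reduceCurve_baseChange] at hre₁ hre₂ ⊢
  set Vr := M.map r with hVrdef
  -- the reduced coordinates: congruences
  have hxr : r X₁ = r X₂ ↔ w ((X₁ : L) - X₂) < 1 := by
    rw [← sub_eq_zero, ← map_sub, hr]; rfl
  have hnegY : (r (M.toAffine.negY X₂ Y₂) : k) = Vr.toAffine.negY (r X₂) (r Y₂) := by
    rw [hVrdef, Affine.map_negY]
  have hyr : r Y₁ = Vr.toAffine.negY (r X₂) (r Y₂) ↔ w ((Y₁ : L) - V.toAffine.negY X₂ Y₂) < 1 := by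
    rw [← hnegY, ← sub_eq_zero, ← map_sub, hr, coe_model_negY]; rfl
  by_cases hdx : w ((X₁ : L) - X₂) < 1
  · -- `x̃₁ = x̃₂`: then `ỹ₁ = ỹ₂` and the reduced slope is the tangent slope
    have hdy : ¬w ((Y₁ : L) - V.toAffine.negY X₂ Y₂) < 1 := fun h ↦ hne ⟨hdx, h⟩
    have hrX : r X₁ = r X₂ := hxr.mpr hdx
    have hrY : r Y₁ ≠ Vr.toAffine.negY (r X₂) (r Y₂) := fun h ↦ hdy (hyr.mp h)
    have hrY' : r Y₁ = r Y₂ := Affine.Y_eq_of_Y_ne hre₁ hre₂ hrX hrY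
    -- the unit `E = y₁ + y₂ + a₁ x₂ + a₃`
    set E : w.integer := Y₁ - M.toAffine.negY X₂ Y₂ with hEdef
    have hEcoe : (E : L) = (Y₁ : L) - V.toAffine.negY X₂ Y₂ := by
      rw [hEdef, coe_model_negY]; push_cast; rfl
    have hwE : w (E : L) = 1 := le_antisymm E.2 (by rw [hEcoe]; exact not_lt.mp hdy)
    have hE0 : (E : L) ≠ 0 := fun h ↦ by rw [h, map_zero] at hwE; exact zero_ne_one hwE
    have hrE : r E = r Y₁ - Vr.toAffine.negY (r X₁) (r Y₁) := by
      rw [hEdef, map_sub, hnegY, ← hrX, ← hrY']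
    rw [Affine.slope_of_Y_ne hrX hrY]
    by_cases hXeq : (X₁ : L) = X₂
    · -- tangent case `P = Q`
      have hX12 : X₁ = X₂ := Subtype.ext hXeq
      subst hX12
      have hYne : (Y₁ : L) ≠ V.toAffine.negY X₁ Y₂ := by
        intro h
        apply hdy
        rw [h, sub_self, map_zero]
        exact one_pos
      have hY12 : Y₁ = Y₂ := Subtype.ext (Affine.Y_eq_of_Y_ne h₁.1 h₂.1 rfl hYne)
      subst hY12
      rw [Affine.slope_of_Y_ne rfl hYne]
      set N : w.integer := 3 * X₁ ^ 2 + 2 * M.a₂ * X₁ + M.a₄ - M.a₁ * Y₁ with hNdef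
      have hNcoe : (3 * (X₁ : L) ^ 2 + 2 * V.a₂ * X₁ + V.a₄ - V.a₁ * Y₁) = (N : L) := by
        rw [hNdef]; push_cast; rfl
      rw [hNcoe, ← hEcoe]
      refine ⟨by rw [map_div₀, hwE, div_one]; exact N.2, ?_⟩
      rw [reduceFun_div hr N.2 hwE, reduceFun_coe, reduceFun_coe, hrE]
      congr 1
      simp only [hNdef, map_sub, map_add, map_mul, map_pow, map_ofNat, hVrdef,
        WeierstrassCurve.map_a₁, WeierstrassCurve.map_a₂, WeierstrassCurve.map_a₄]
    · -- congruent but distinct `x`-coordinates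
      have hslope : V.toAffine.slope X₁ X₂ Y₁ Y₂ = ((Y₁ : L) - Y₂) / ((X₁ : L) - X₂) :=
        Affine.slope_of_X_ne hXeq
      set N : w.integer := X₁ ^ 2 + X₁ * X₂ + X₂ ^ 2 + M.a₂ * (X₁ + X₂) + M.a₄ - M.a₁ * Y₁
        with hNdef
      have key : (Y₁ - Y₂) * E = (X₁ - X₂) * N := by
        rw [hEdef, hNdef, Affine.negY]
        rw [Affine.equation_iff] at he₁ he₂
        linear_combination he₁ - he₂
      have hX0 : (X₁ : L) - X₂ ≠ 0 := sub_ne_zero.mpr hXeq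
      have hslope' : V.toAffine.slope X₁ X₂ Y₁ Y₂ = (N : L) / (E : L) := by
        rw [hslope, div_eq_div_iff hX0 hE0]
        have := congrArg ((↑) : w.integer → L) key
        push_cast at this
        linear_combination this
      rw [hslope']
      refine ⟨by rw [map_div₀, hwE, div_one]; exact N.2, ?_⟩
      rw [reduceFun_div hr N.2 hwE, reduceFun_coe, reduceFun_coe, hrE]
      congr 1
      simp only [hNdef, map_sub, map_add, map_mul, map_pow, hVrdef, ← hrX,
        WeierstrassCurve.map_a₁, WeierstrassCurve.map_a₂, WeierstrassCurve.map_a₄]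
      ring
  · -- `x̃₁ ≠ x̃₂`: the chord, with unit denominator
    have hX : (X₁ : L) ≠ X₂ := fun h ↦ hdx (by rw [h, sub_self, map_zero]; exact one_pos)
    have hrX : r X₁ ≠ r X₂ := fun h ↦ hdx (hxr.mp h)
    have hwD : w ((X₁ : L) - X₂) = 1 := le_antisymm (w.map_sub_le X₁.2 X₂.2) (not_lt.mp hdx)
    rw [Affine.slope_of_X_ne hX, Affine.slope_of_X_ne hrX]
    refine ⟨by rw [map_div₀, hwD, div_one]; exact w.map_sub_le Y₁.2 Y₂.2, ?_⟩
    rw [reduceFun_div hr (w.map_sub_le Y₁.2 Y₂.2) hwD, reduceFun_sub r Y₁.2 Y₂.2,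
      reduceFun_sub r X₁.2 X₂.2, reduceFun_coe, reduceFun_coe, reduceFun_coe, reduceFun_coe]


/-! ## Reduction of points -/

/-- Two affine points with equal coordinates are equal (transport of the nonsingularity
proof).  Equational twin of the tree's `Literature.NumberTheory.EllipticCurves.UnivEC.some_eq_some_of_eq`
(`DivisionPolynomialMultiplication`, existential form), kept because this form is the one
consumed by `refine` below. [folklore] -/
theorem point_some_eq_some {R : Type*} [CommRing R] {W : WeierstrassCurve R} {x x' y y' : R}
    (hx : x = x') (hy : y = y') {h : W.toAffine.Nonsingular x y}
    {h' : W.toAffine.Nonsingular x' y'} : Affine.Point.some x y h = Affine.Point.some x' y' h' := by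
  subst hx hy
  rfl

variable (r) (w)

/-- **The reduction map on points** `V(L) → Ṽ(k)`, `P ↦ P̃` (Silverman, *AEC*, VII.§2): `O ↦ Õ`;
an affine point `(x, y)` with `w x ≤ 1` (hence `w y ≤ 1`) goes to `(x̃, ỹ)`; a non-integral
affine point (`w x > 1`, the kernel of reduction `E₁(L)`, VII.2.1) goes to `Õ`.  The target `Ṽ`
is any Weierstrass equation over `k`; the map is meaningful when `Ṽ = reduceCurve r V` and `V`
is `w`-integral with `w Δ = 1` (then `(x̃, ỹ)` is a nonsingular point of `Ṽ`,
`nonsingular_reduceFun`; in general a junk value `Õ` is returned when it is not).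
[cite: SilvermanAEC2009, VII.§2 (the reduction map `E(K) → Ẽ(k)`)] -/
def reducePoint (Vt : WeierstrassCurve k) : V.toAffine.Point → Vt.toAffine.Point
  | .zero => 0
  | .some x y _ =>
    if h : w x ≤ 1 ∧ Vt.toAffine.Nonsingular (reduceFun r x) (reduceFun r y) then
      .some _ _ h.2
    else 0

/-- **Integral points**: `O`, and the affine points `(x, y)` with `w x ≤ 1` (hence `w y ≤ 1`) —
that is, `O` together with the points outside the kernel of reduction
`E₁(L) = {P ∈ E(L) : P̃ = Õ}` of Silverman, *AEC*, VII.§2 (which consists of `O` and the affine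
points with `w x > 1`).  Compare the complementary predicate `WeierstrassCurve.IsInReductionKernel`
of the tree file `EllipticCurves/FormalGroup` (`P = O ∨ 1 < ‖x(P)‖`, over `ℚ_p`): an affine point
is integral iff it is not in the kernel of reduction, while `O` satisfies both.
[cite: SilvermanAEC2009, VII.§2] -/
def IsIntegralPoint : V.toAffine.Point → Prop
  | .zero => True
  | .some x _ _ => w x ≤ 1

variable {r} {w}

/-- `O` is an integral point. [folklore] -/
@[simp]
theorem isIntegralPoint_zero : IsIntegralPoint w (0 : V.toAffine.Point) := trivial

/-- An affine point is integral iff `w x ≤ 1`. [folklore] -/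
@[simp]
theorem isIntegralPoint_some_iff {x y : L} {h : V.toAffine.Nonsingular x y} :
    IsIntegralPoint w (Affine.Point.some x y h) ↔ w x ≤ 1 := Iff.rfl

/-- `-P` is integral iff `P` is. [folklore] -/
theorem isIntegralPoint_neg_iff {P : V.toAffine.Point} :
    IsIntegralPoint w (-P) ↔ IsIntegralPoint w P := by
  rcases P with _ | ⟨x, y, h⟩
  · exact Iff.rfl
  · rw [Affine.Point.neg_some]
    exact Iff.rfl

/-- **Prime-to-`p` torsion is integral** (Silverman AEC Prop. VII.3.1(a), "`E₁(K)` has no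
nontrivial points of order `m`" for `m` prime to `char k`, in valuation form): on a `w`-integral
equation, a point killed by `n` with `w n = 1` is integral (`Literature.NumberTheory.EllipticCurves.val_le_one_of_zsmul_eq_zero`, by
division polynomials; no minimality or good-reduction hypothesis is needed).
[cite: SilvermanAEC2009, Prop. VII.3.1(a)] -/
theorem isIntegralPoint_of_zsmul_eq_zero [V.IsIntegral w.integer] {n : ℤ} (hn : w n = 1)
    {P : V.toAffine.Point} (hP : n • P = 0) : IsIntegralPoint w P := by
  rcases P with _ | ⟨x, y, h⟩
  · trivial
  · exact val_le_one_of_zsmul_eq_zero hn hP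

variable {Vt : WeierstrassCurve k}

/-- `Õ` is the reduction of `O`. [folklore] -/
@[simp]
theorem reducePoint_zero : reducePoint w r Vt (0 : V.toAffine.Point) = 0 := rfl

/-- Points of the kernel of reduction go to `Õ`. Silverman, *AEC*, VII.§2 (`E₁`). [folklore] -/
theorem reducePoint_some_of_one_lt {x y : L} {h : V.toAffine.Nonsingular x y} (hx : 1 < w x) :
    reducePoint w r Vt (Affine.Point.some x y h) = 0 := by
  simp only [reducePoint, not_le.mpr hx, false_and, ↓reduceDIte]

/-- A non-integral point reduces to `Õ`. [folklore] -/
theorem reducePoint_of_not_isIntegralPoint {P : V.toAffine.Point} (hP : ¬IsIntegralPoint w P) :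
    reducePoint w r Vt P = 0 := by
  rcases P with _ | ⟨x, y, h⟩
  · rfl
  · exact reducePoint_some_of_one_lt (not_le.mp hP)

/-- **The reduction of an integral affine point** is the affine point `(x̃, ỹ)` of `Ṽ`
(`V` integral, `w Δ = 1`, `ker r = 𝔪_w`, `Ṽ` the reduced equation).
Silverman, *AEC*, VII.§2. [cite: SilvermanAEC2009, VII.§2] -/
theorem reducePoint_some [V.IsIntegral w.integer]
    (hr : ∀ a : w.integer, r a = 0 ↔ w (a : L) < 1) (hΔ : w V.Δ = 1) (hVt : reduceCurve r V = Vt)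
    {x y : L} (h : V.toAffine.Nonsingular x y) (hx : w x ≤ 1) :
    reducePoint w r Vt (Affine.Point.some x y h) =
      Affine.Point.some (reduceFun r x) (reduceFun r y)
        (hVt ▸ nonsingular_reduceFun hr hΔ h.1 hx) := by
  have hns : Vt.toAffine.Nonsingular (reduceFun r x) (reduceFun r y) :=
    hVt ▸ nonsingular_reduceFun hr hΔ h.1 hx
  simp only [reducePoint, hx, hns, and_self, ↓reduceDIte]

/-- An integral affine point does not reduce to `Õ`: the kernel of reduction is exactly `E₁(L)`.
Silverman, *AEC*, VII.§2, Prop. VII.2.1 (`ker = E₁`). [cite: SilvermanAEC2009, Prop. VII.2.1] -/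
theorem reducePoint_some_ne_zero [V.IsIntegral w.integer]
    (hr : ∀ a : w.integer, r a = 0 ↔ w (a : L) < 1) (hΔ : w V.Δ = 1) (hVt : reduceCurve r V = Vt)
    {x y : L} (h : V.toAffine.Nonsingular x y) (hx : w x ≤ 1) :
    reducePoint w r Vt (Affine.Point.some x y h) ≠ 0 := by
  rw [reducePoint_some hr hΔ hVt h hx]
  exact Affine.Point.some_ne_zero _

/-- For an integral point, `P̃ = Õ ↔ P = O`. Silverman, *AEC*, Prop. VII.2.1. [folklore] -/
theorem reducePoint_eq_zero_iff [V.IsIntegral w.integer]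
    (hr : ∀ a : w.integer, r a = 0 ↔ w (a : L) < 1) (hΔ : w V.Δ = 1) (hVt : reduceCurve r V = Vt)
    {P : V.toAffine.Point} (hP : IsIntegralPoint w P) : reducePoint w r Vt P = 0 ↔ P = 0 := by
  rcases P with _ | ⟨x, y, h⟩
  · exact ⟨fun _ ↦ rfl, fun _ ↦ rfl⟩
  · exact ⟨fun h0 ↦ absurd h0 (reducePoint_some_ne_zero hr hΔ hVt h hP),
      fun h0 ↦ absurd h0 (Affine.Point.some_ne_zero _)⟩

/-- **Reduction commutes with negation** (on any `w`-integral equation, for any ring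
homomorphism `r : 𝒪_w → k` and `Ṽ` the reduced equation). Silverman, *AEC*, VII.§2. [folklore] -/
theorem reducePoint_neg [V.IsIntegral w.integer] (hVt : reduceCurve r V = Vt)
    (P : V.toAffine.Point) : reducePoint w r Vt (-P) = -reducePoint w r Vt P := by
  rcases P with _ | ⟨x, y, h⟩
  · rfl
  · rw [Affine.Point.neg_some]
    by_cases hx : w x ≤ 1
    · have hy : w y ≤ 1 := val_y_le_one h.1 hx
      have hneg : reduceFun r (V.toAffine.negY x y) =
          Vt.toAffine.negY (reduceFun r x) (reduceFun r y) := by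
        rw [reduceFun_negY hx hy, hVt]
      by_cases hns : Vt.toAffine.Nonsingular (reduceFun r x) (reduceFun r y)
      · have hns' : Vt.toAffine.Nonsingular (reduceFun r x) (reduceFun r (V.toAffine.negY x y)) := by
          rw [hneg]
          exact (Affine.nonsingular_neg _ _).mpr hns
        simp only [reducePoint, hx, hns, hns', and_self, ↓reduceDIte, Affine.Point.neg_some]
        exact point_some_eq_some rfl hneg
      · have hns' : ¬Vt.toAffine.Nonsingular (reduceFun r x) (reduceFun r (V.toAffine.negY x y)) := by
          rw [hneg]
          exact fun h' ↦ hns ((Affine.nonsingular_neg _ _).mp h')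
        simp only [reducePoint, hx, hns, hns', and_false, ↓reduceDIte, neg_zero]
    · rw [not_le] at hx
      rw [reducePoint_some_of_one_lt hx, reducePoint_some_of_one_lt hx, neg_zero]

/-- **The reduction map is additive on integral points** (Silverman, *AEC*, Prop. VII.2.1 —
the reduction map `E₀(K) → Ẽ_ns(k)` is a homomorphism — for two points outside the kernel of
reduction): on a `w`-integral equation with `w Δ = 1` (and `ker r = 𝔪_w`, `Ṽ` the reduced
equation), if `P` and `Q` are integral points (each `O` or with integral `x`-coordinate), then
`\widetilde{P + Q} = P̃ + Q̃`.  Proof on the chord–tangent formulas: if `P̃ = -Q̃` then `P + Q`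
is `O` or lies in the kernel of reduction (`Literature.NumberTheory.EllipticCurves.add_eq_zero_or_one_lt_val`), and both sides are
`Õ`; otherwise the slope through `P, Q` is integral and reduces to the slope through `P̃, Q̃`
(`val_slope_le_one`), so `P + Q` is integral with coordinates integral polynomials in it.  (The
remaining case of VII.2.1, `P` or `Q` in the kernel of reduction `E₁`, which Silverman treats
with the formal group, is not covered; the tree's `Literature.NumberTheory.EllipticCurves.val_addX_le_one_of_one_lt` is the case
`P ∈ E₁`, `Q̃ ≠ Õ`.)
[cite: SilvermanAEC2009, Prop. VII.2.1] -/
theorem reducePoint_add [hV : V.IsIntegral w.integer]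
    (hr : ∀ a : w.integer, r a = 0 ↔ w (a : L) < 1) (hΔ : w V.Δ = 1) (hVt : reduceCurve r V = Vt)
    {P Q : V.toAffine.Point} (hP : IsIntegralPoint w P) (hQ : IsIntegralPoint w Q) :
    reducePoint w r Vt (P + Q) = reducePoint w r Vt P + reducePoint w r Vt Q := by
  rcases P with _ | ⟨x₁, y₁, h₁⟩
  · rw [← Affine.Point.zero_def, zero_add, reducePoint_zero, zero_add]
  rcases Q with _ | ⟨x₂, y₂, h₂⟩
  · rw [← Affine.Point.zero_def, add_zero, reducePoint_zero, add_zero]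
  have hx₁ : w x₁ ≤ 1 := hP
  have hx₂ : w x₂ ≤ 1 := hQ
  have hy₁ : w y₁ ≤ 1 := val_y_le_one h₁.1 hx₁
  have hy₂ : w y₂ ≤ 1 := val_y_le_one h₂.1 hx₂
  rw [reducePoint_some hr hΔ hVt h₁ hx₁, reducePoint_some hr hΔ hVt h₂ hx₂]
  -- the reduced coordinates: congruences
  have hxr : reduceFun r x₁ = reduceFun r x₂ ↔ w (x₁ - x₂) < 1 := reduceFun_eq_iff hr hx₁ hx₂
  have hyr : reduceFun r y₁ = Vt.toAffine.negY (reduceFun r x₂) (reduceFun r y₂) ↔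
      w (y₁ - V.toAffine.negY x₂ y₂) < 1 := by
    rw [← hVt, ← reduceFun_negY hx₂ hy₂]
    refine reduceFun_eq_iff hr hy₁ ?_
    simpa only [reduceFun_coe] using
      (show w (V.toAffine.negY x₂ y₂) ≤ 1 from by
        obtain ⟨M, rfl⟩ := hV.integral
        rw [show x₂ = ((⟨x₂, hx₂⟩ : w.integer) : L) from rfl,
          show y₂ = ((⟨y₂, hy₂⟩ : w.integer) : L) from rfl, coe_model_negY]
        exact (M.toAffine.negY ⟨x₂, hx₂⟩ ⟨y₂, hy₂⟩).2)
  by_cases hA : w (x₁ - x₂) < 1 ∧ w (y₁ - V.toAffine.negY x₂ y₂) < 1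
  · -- opposite reductions: `P + Q` is `O` or lies in the kernel of reduction; both reduce to `Õ`
    rcases add_eq_zero_or_one_lt_val hΔ (h₁ := h₁) (h₂ := h₂) hx₁ hx₂ hA.1 hA.2 with
      h0 | ⟨x₃, y₃, h₃, h3, hlt⟩
    · rw [h0, reducePoint_zero, Affine.Point.add_of_Y_eq (hxr.mpr hA.1) (hyr.mpr hA.2)]
    · rw [h3, reducePoint_some_of_one_lt hlt,
        Affine.Point.add_of_Y_eq (hxr.mpr hA.1) (hyr.mpr hA.2)]
  · -- `P̃ ≠ -Q̃`
    have hA' : ¬(reduceFun r x₁ = reduceFun r x₂ ∧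
        reduceFun r y₁ = Vt.toAffine.negY (reduceFun r x₂) (reduceFun r y₂)) :=
      fun h ↦ hA ⟨hxr.mp h.1, hyr.mp h.2⟩
    have hB : ¬(x₁ = x₂ ∧ y₁ = V.toAffine.negY x₂ y₂) := by
      rintro ⟨hx, hy⟩
      refine hA ⟨?_, ?_⟩
      · rw [hx, sub_self, map_zero]; exact one_pos
      · rw [hy, sub_self, map_zero]; exact one_pos
    rw [Affine.Point.add_some hB, Affine.Point.add_some hA']
    obtain ⟨hl, hrl⟩ := val_slope_le_one hr hΔ h₁ h₂ hx₁ hx₂ hA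
    -- compute in the model: the slope is integral, hence so is `P + Q`
    obtain ⟨M, rfl⟩ := hV.integral
    obtain ⟨X₁, rfl⟩ : ∃ X : w.integer, (X : L) = x₁ := ⟨⟨x₁, hx₁⟩, rfl⟩
    obtain ⟨Y₁, rfl⟩ : ∃ Y : w.integer, (Y : L) = y₁ := ⟨⟨y₁, hy₁⟩, rfl⟩
    obtain ⟨X₂, rfl⟩ : ∃ X : w.integer, (X : L) = x₂ := ⟨⟨x₂, hx₂⟩, rfl⟩
    obtain ⟨Λ, hΛ⟩ : ∃ Λ : w.integer, (Λ : L) = (M.baseChange L).toAffine.slope X₁ X₂ Y₁ y₂ :=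
      ⟨⟨_, hl⟩, rfl⟩
    have hX3 : w ((M.baseChange L).toAffine.addX X₁ X₂
        ((M.baseChange L).toAffine.slope X₁ X₂ Y₁ y₂)) ≤ 1 := by
      rw [← hΛ, coe_model_addX]
      exact (M.toAffine.addX X₁ X₂ Λ).2
    rw [reducePoint_some hr hΔ hVt _ hX3]
    refine point_some_eq_some ?_ ?_
    · rw [← hΛ, coe_model_addX, reduceFun_coe, ← hVt, ← hrl, ← hΛ,
        reduceFun_coe, reduceFun_coe, reduceFun_coe, reduceCurve_baseChange, Affine.map_addX]
    · rw [← hΛ, coe_model_addY, reduceFun_coe, ← hVt, ← hrl, ← hΛ, reduceFun_coe,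
        reduceFun_coe, reduceFun_coe, reduceFun_coe, reduceCurve_baseChange, Affine.map_addY]

/-- **Reduction is additive on prime-to-`p` torsion**: if `n P = n Q = O` with `w n = 1` then
`\widetilde{P + Q} = P̃ + Q̃`. Silverman, *AEC*, VII.2.1 with VII.3.1(a). [folklore] -/
theorem reducePoint_add_of_zsmul_eq_zero [V.IsIntegral w.integer]
    (hr : ∀ a : w.integer, r a = 0 ↔ w (a : L) < 1) (hΔ : w V.Δ = 1) (hVt : reduceCurve r V = Vt)
    {n : ℤ} (hn : w n = 1) {P Q : V.toAffine.Point} (hP : n • P = 0) (hQ : n • Q = 0) :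
    reducePoint w r Vt (P + Q) = reducePoint w r Vt P + reducePoint w r Vt Q :=
  reducePoint_add hr hΔ hVt (isIntegralPoint_of_zsmul_eq_zero hn hP)
    (isIntegralPoint_of_zsmul_eq_zero hn hQ)

/-! ## The reduction homomorphism on prime-to-`p` torsion and its injectivity -/

variable (w) (V)

/-- The **prime-to-`𝔪_w` torsion** of `V(L)`: points killed by some integer `n` with `w n = 1`
(a subgroup; for a place above `p`, the torsion of order prime to `p`). Silverman, *AEC*,
Prop. VII.3.1 ("`m ≥ 1` relatively prime to `char k`"). [cite: SilvermanAEC2009, Prop. VII.3.1] -/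
def goodTorsion : AddSubgroup V.toAffine.Point where
  carrier := {P | ∃ n : ℤ, w n = 1 ∧ n • P = 0}
  zero_mem' := ⟨1, by simp, by simp⟩
  add_mem' := by
    rintro P Q ⟨m, hm, hP⟩ ⟨n, hn, hQ⟩
    refine ⟨m * n, by rw [Int.cast_mul, map_mul, hm, hn, one_mul], ?_⟩
    rw [smul_add, mul_comm m n, mul_smul, hP, smul_zero, mul_comm n m, mul_smul, hQ, smul_zero,
      add_zero]
  neg_mem' := by
    rintro P ⟨n, hn, hP⟩
    exact ⟨n, hn, by rw [smul_neg, hP, neg_zero]⟩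

variable {w} {V}

/-- Membership in the prime-to-`𝔪_w` torsion. [folklore] -/
theorem mem_goodTorsion_iff {P : V.toAffine.Point} :
    P ∈ goodTorsion w V ↔ ∃ n : ℤ, w n = 1 ∧ n • P = 0 := Iff.rfl

/-- A point killed by `n` with `w n = 1` lies in the prime-to-`𝔪_w` torsion. [folklore] -/
theorem mem_goodTorsion_of_zsmul_eq_zero {n : ℤ} (hn : w n = 1) {P : V.toAffine.Point}
    (hP : n • P = 0) : P ∈ goodTorsion w V := ⟨n, hn, hP⟩

/-- Points of the prime-to-`𝔪_w` torsion are integral (VII.3.1(a)).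
[cite: SilvermanAEC2009, Prop. VII.3.1(a)] -/
theorem isIntegralPoint_of_mem_goodTorsion [V.IsIntegral w.integer] {P : V.toAffine.Point}
    (hP : P ∈ goodTorsion w V) : IsIntegralPoint w P := by
  obtain ⟨n, hn, h⟩ := hP
  exact isIntegralPoint_of_zsmul_eq_zero hn h

variable (w) (r)

/-- **The reduction homomorphism on prime-to-`p` torsion** `E(L)[p'] → Ẽ(k)` (Silverman,
*AEC*, Prop. VII.2.1 restricted to the prime-to-`p` torsion, which is integral by
Prop. VII.3.1(a)): on a `w`-integral equation with `w Δ = 1`, for `ker r = 𝔪_w` and `Ṽ` the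
reduced equation, `P ↦ P̃` is additive on the subgroup of points killed by an integer `n` with
`w n = 1`. [cite: SilvermanAEC2009, Prop. VII.2.1 and Prop. VII.3.1(a)] -/
def reduceHom [V.IsIntegral w.integer] (hr : ∀ a : w.integer, r a = 0 ↔ w (a : L) < 1)
    (hΔ : w V.Δ = 1) (hVt : reduceCurve r V = Vt) : goodTorsion w V →+ Vt.toAffine.Point where
  toFun P := reducePoint w r Vt (P : V.toAffine.Point)
  map_zero' := rfl
  map_add' P Q := reducePoint_add hr hΔ hVt (isIntegralPoint_of_mem_goodTorsion P.2)
    (isIntegralPoint_of_mem_goodTorsion Q.2)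

variable {w} {r}

/-- Unfolding `reduceHom`. [folklore] -/
@[simp]
theorem reduceHom_apply [V.IsIntegral w.integer] (hr : ∀ a : w.integer, r a = 0 ↔ w (a : L) < 1)
    (hΔ : w V.Δ = 1) (hVt : reduceCurve r V = Vt) (P : goodTorsion w V) :
    reduceHom w r hr hΔ hVt P = reducePoint w r Vt (P : V.toAffine.Point) := rfl

/-- **Prime-to-`p` torsion injects into the reduction** (Silverman, *AEC*, Prop. VII.3.1(b):
"the reduction map `E(K)[m] → Ẽ(k)` is injective" for `m` prime to `char k`; here for a general
valued field, `w`-integral equation with `w Δ = 1`): the kernel of reduction consists of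
non-integral points, and prime-to-`p` torsion points are integral.
[cite: SilvermanAEC2009, Prop. VII.3.1(b)] -/
theorem injective_reduceHom [V.IsIntegral w.integer]
    (hr : ∀ a : w.integer, r a = 0 ↔ w (a : L) < 1) (hΔ : w V.Δ = 1) (hVt : reduceCurve r V = Vt) :
    Function.Injective (reduceHom w r hr hΔ hVt) := by
  rw [injective_iff_map_eq_zero]
  intro P hP
  exact Subtype.ext
    ((reducePoint_eq_zero_iff hr hΔ hVt (isIntegralPoint_of_mem_goodTorsion P.2)).mp hP)

/-- Reduction commutes with integer multiples on prime-to-`p` torsion. [folklore] -/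
theorem reducePoint_zsmul [V.IsIntegral w.integer]
    (hr : ∀ a : w.integer, r a = 0 ↔ w (a : L) < 1) (hΔ : w V.Δ = 1) (hVt : reduceCurve r V = Vt)
    (m : ℤ) {P : V.toAffine.Point} (hP : P ∈ goodTorsion w V) :
    reducePoint w r Vt (m • P) = m • reducePoint w r Vt P := by
  change reduceHom w r hr hΔ hVt ⟨m • P, zsmul_mem hP m⟩ = m • reduceHom w r hr hΔ hVt ⟨P, hP⟩
  rw [← map_zsmul]
  rfl

end Literature.NumberTheory.EllipticCurves
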